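import Literature.RepresentationTheory.GeneralLinear.WreathHighestWeight
import Literature.NumberTheory.DiophantineGeometry.GLHighestWeightFacts
import HarnessLib

/-!
# The plethysm coefficient `a_λ(n,m)` as the dimension of the `S_n ≀ S_m`-invariant
# highest-weight vectors of `V^{⊗nm}` (BIP 2019 (4.1); Fischer–Ikenmeyer 2020, §2 and Fact 1)

The barrier file `Literature/Barriers/ValiantsHypothesis/KroneckerPositivityHardness.lean` measures
PLETHYSMPOSITIVITY by the tree's `plethysmCoeffOfPartition k N m λ` — the multiplicity of the dual
weight `λ^*` in G20's coordinate ring `k[Symᵐ (k^N)] = ⊕_n Symⁿ(Symᵐ V)^*` (`coordRep`), i.e. the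
classical `a_λ(n,m)` for `λ ⊢ n·m` with at most `N` parts (Fischer–Ikenmeyer 2020, §2, eq. (2):
"`Symⁿ Symᵐ V = ⊕_λ (S^λ V)^{⊕ a_λ(n,m)}`"). This file identifies it with the word model of
`WreathHighestWeight.lean`:

* `highestWeightSpaceCoordRepEquiv` : `HW_{λ^*}(k[Symᵐ (k^N)]) ≃ₗ wreathHW k N 1 λ` — the
  dictionary of `PlethysmStability.lean` §5 (`wordOfForm`/`formOfWord`, the full polarisation read
  on flat words through the order-reversing enumeration `Fin.rev`, BIP 2019 (4.1):
  "`Sym^d Sym^n V` as the space of `S_d ≀ S_n`-invariants in `⊗^{dn} V`"), packaged as a linear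
  isomorphism (a weight pins the degree, `isHomogeneous_of_mem_highestWeightSpace`, so every
  highest-weight vector of weight `λ^*` is a form of degree `n` and the polarisation is injective on
  it; surjectivity is `wordOfForm_formOfWord`);
* `plethysmCoeffOfPartition_eq_finrank_wreathHW` : `a_λ(n,m) = dim wreathHW k N 1 λ`
  (`m ≠ 0`, `ℓ(λ) ≤ N`, characteristic zero);
* with Fact 1 of `WreathHighestWeight.lean`: `a_λ(n,m) = dim wreathHW k N' s λᵀ`
  (`plethysmCoeffOfPartition_eq_finrank_wreathHW_transpose`) — "`a_λ(n,3)` equals the multiplicity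
  of the irreducible component `S^{λᵀ} V` in `Λⁿ Λ³ V`" (FI §5, proof of Thm. 4; for even `m` the
  character `s` cuts out `Symⁿ Λᵐ V`, FI Fact 1) — and the positivity forms used by the hardness
  reductions, independent of the alphabet sizes `N ≥ ℓ(λ)`, `N' ≥ ℓ(λᵀ)`.

## References

* [FischerIkenmeyer2020] N. Fischer, C. Ikenmeyer, Comput. Complexity 29 (2020) 8, §2 (eq. (2),
  Fact 1), §5 (proof of Thm. 4).
* [BurgisserIkenmeyerPanovaJAMS2019] P. Bürgisser, C. Ikenmeyer, G. Panova, J. AMS 32 (2019), §4 (4.1).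
* [BurgisserEtAl2011] BLMW, SIAM J. Comput. 40 (2011), §4.4 (a weight pins the degree; duals).
-/

noncomputable section

open scoped BigOperators

namespace Literature.RepresentationTheory.GeneralLinear

open Literature.NumberTheory.DiophantineGeometry Literature.Computability.AlgebraicComplexity

section Dictionary

variable {k : Type*} [Field k] [CharZero k] {N n m : ℕ}

/-- The order-reversing enumeration of the alphabet used to read forms on words (so that letter
`0` is the greatest variable, BIP's `e_1`). [folklore] -/
theorem strictAnti_revPerm : StrictAnti (⇑(Fin.revPerm : Equiv.Perm (Fin N))) :=
  fun _ _ h => Fin.rev_lt_rev.mpr h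

/-- The weight of the word model attached to the dual weight `λ^*` of `coordRep` read through
`Fin.rev` is `λ` itself: `-λ^*(rev i) = λ_i`. [folklore] -/
theorem neg_dualOfPartition_rev {d : ℕ} (lam : Nat.Partition d) :
    (fun i => -(Weight.dualOfPartition N lam) ((Fin.revPerm : Equiv.Perm (Fin N)) i)) =
      Weight.ofPartition N lam := by
  funext i
  simp [Weight.dualOfPartition, Weight.dual, Fin.revPerm_apply, Fin.rev_rev]

omit [CharZero k] in
/-- `wordOfForm` is additive (the polarisation is linear). [folklore] -/
theorem wordOfForm_add (ρ : Fin N ≃ Fin N) (h h' : MvPolynomial (DegIdx (Fin N) m) k) :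
    wordOfForm (k := k) ρ m n (h + h') = wordOfForm ρ m n h + wordOfForm ρ m n h' := by
  funext w
  rw [Pi.add_apply, wordOfForm_apply, wordOfForm_apply, wordOfForm_apply, ← polarizeLin_apply,
    map_add, Pi.add_apply, polarizeLin_apply, polarizeLin_apply]

/-- A highest-weight vector of `k[Symᵐ (k^N)]` of weight `λ^*`, `λ ⊢ n·m` with at most `N` parts,
is a form of degree `n` (`m ≠ 0`; a weight pins the degree, BLMW §4.4). [cite: BurgisserEtAl2011, §4.4] -/
theorem isHomogeneous_of_mem_highestWeightSpace_dualOfPartition (hm : m ≠ 0)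
    {lam : Nat.Partition (n * m)} (hlam : lam.parts.card ≤ N)
    {h : MvPolynomial (DegIdx (Fin N) m) k}
    (hh : h ∈ highestWeightSpace (coordRep (Fin N) k m) (Weight.dualOfPartition N lam)) :
    h.IsHomogeneous n := by
  refine isHomogeneous_of_mem_highestWeightSpace hm hh ?_
  rw [Weight.dualOfPartition, Weight.size_dual, Weight.size_ofPartition_holds hlam, Nat.mul_comm]

/-- The transported polarisation of a highest-weight vector of weight `λ^*` lies in
`wreathHW k N 1 λ` (it is an `S_n ≀ S_m`-invariant highest-weight vector of weight `λ`, BIP (4.1)).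
[cite: BurgisserIkenmeyerPanovaJAMS2019, §4 (4.1)] -/
theorem wordOfForm_mem_wreathHW (hm : m ≠ 0) {lam : Nat.Partition (n * m)} (hlam : lam.parts.card ≤ N)
    {h : MvPolynomial (DegIdx (Fin N) m) k}
    (hh : h ∈ highestWeightSpace (coordRep (Fin N) k m) (Weight.dualOfPartition N lam)) :
    wordOfForm (Fin.revPerm : Equiv.Perm (Fin N)) m n h ∈
      wreathHW k N (1 : ↥(blockPerms n m) →* ℤˣ) (Weight.ofPartition N lam) := by
  refine ⟨?_, fun τ => ?_⟩
  · have := wordOfForm_mem_highestWeightSpace (M := N) strictAnti_revPerm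
      (isHomogeneous_of_mem_highestWeightSpace_dualOfPartition hm hlam hh) hh
    rwa [neg_dualOfPartition_rev] at this
  · rw [MonoidHom.one_apply, Units.val_one, Int.cast_one, one_smul]
    exact wordPerm_wordOfForm _ h τ.2

omit [CharZero k] in
/-- A vector of `wreathHW k N 1 λ` is `S_n ≀ S_m`-invariant. [folklore] -/
theorem wordPerm_eq_of_mem_wreathHW_one {lam : Weight (Fin N)} {x : Word N (n * m) → k}
    (hx : x ∈ wreathHW k N (1 : ↥(blockPerms n m) →* ℤˣ) lam) :
    ∀ τ ∈ blockPerms n m, wordPerm k τ x = x := fun τ hτ => by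
  have := hx.2 ⟨τ, hτ⟩
  rwa [MonoidHom.one_apply, Units.val_one, Int.cast_one, one_smul] at this

/-- The form of an invariant highest-weight vector of the word model is a highest-weight vector of
`k[Symᵐ (k^N)]` of weight `λ^*` (`formOfWord_mem_highestWeightSpace`).
[cite: BurgisserIkenmeyerPanovaJAMS2019, §4 (4.1)] -/
theorem formOfWord_mem_highestWeightSpace_dualOfPartition {d : ℕ} {lam : Nat.Partition d}
    {x : Word N (n * m) → k}
    (hx : x ∈ wreathHW k N (1 : ↥(blockPerms n m) →* ℤˣ) (Weight.ofPartition N lam)) :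
    formOfWord (Fin.revPerm : Equiv.Perm (Fin N)) m n x ∈
      highestWeightSpace (coordRep (Fin N) k m) (Weight.dualOfPartition N lam) := by
  refine formOfWord_mem_highestWeightSpace (M := N) strictAnti_revPerm
    (wordPerm_eq_of_mem_wreathHW_one hx) ?_
  rw [neg_dualOfPartition_rev]
  exact hx.1

variable (k N)

/-- The dictionary `h ↦ wordOfForm rev m n h` as a linear map
`HW_{λ^*}(k[Symᵐ (k^N)]) → wreathHW k N 1 λ`. [cite: BurgisserIkenmeyerPanovaJAMS2019, §4 (4.1)] -/
def toWreathHW (hm : m ≠ 0) (lam : Nat.Partition (n * m)) (hlam : lam.parts.card ≤ N) :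
    ↥(highestWeightSpace (coordRep (Fin N) k m) (Weight.dualOfPartition N lam)) →ₗ[k]
      ↥(wreathHW k N (1 : ↥(blockPerms n m) →* ℤˣ) (Weight.ofPartition N lam)) where
  toFun h := ⟨wordOfForm (Fin.revPerm : Equiv.Perm (Fin N)) m n h.1,
    wordOfForm_mem_wreathHW hm hlam h.2⟩
  map_add' _ _ := Subtype.ext (wordOfForm_add _ _ _)
  map_smul' c _ := Subtype.ext (wordOfForm_smul _ c _)

/-- `toWreathHW` on underlying functions (unfolding lemma). [folklore] -/
@[simp]
theorem coe_toWreathHW (hm : m ≠ 0) (lam : Nat.Partition (n * m)) (hlam : lam.parts.card ≤ N)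
    (h : ↥(highestWeightSpace (coordRep (Fin N) k m) (Weight.dualOfPartition N lam))) :
    ((toWreathHW k N hm lam hlam h : ↥(wreathHW k N (1 : ↥(blockPerms n m) →* ℤˣ)
      (Weight.ofPartition N lam))) : Word N (n * m) → k) =
      wordOfForm (Fin.revPerm : Equiv.Perm (Fin N)) m n h.1 :=
  rfl

/-- `toWreathHW` is bijective: injective because the polarisation is injective on forms of degree
`n` (and every highest-weight vector of weight `λ^*` is one), surjective by `formOfWord`.
[cite: BurgisserIkenmeyerPanovaJAMS2019, §4 (4.1)] -/
theorem toWreathHW_bijective (hm : m ≠ 0) (lam : Nat.Partition (n * m)) (hlam : lam.parts.card ≤ N) :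
    Function.Bijective (toWreathHW k N hm lam hlam) := by
  refine ⟨fun h h' hhh' => ?_, fun x => ?_⟩
  · exact Subtype.ext (eq_of_wordOfForm_eq (Fin.revPerm : Equiv.Perm (Fin N))
      (isHomogeneous_of_mem_highestWeightSpace_dualOfPartition hm hlam h.2)
      (isHomogeneous_of_mem_highestWeightSpace_dualOfPartition hm hlam h'.2)
      (congrArg Subtype.val hhh'))
  · refine ⟨⟨formOfWord (Fin.revPerm : Equiv.Perm (Fin N)) m n (x : Word N (n * m) → k),
      formOfWord_mem_highestWeightSpace_dualOfPartition x.2⟩, Subtype.ext ?_⟩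
    rw [coe_toWreathHW]
    exact wordOfForm_formOfWord _ (wordPerm_eq_of_mem_wreathHW_one x.2)

/-- **The dictionary as a linear isomorphism**: `HW_{λ^*}(k[Symᵐ (k^N)]) ≃ₗ wreathHW k N 1 λ`,
`h ↦ wordOfForm rev m n h`, inverse `formOfWord` (`λ ⊢ n·m` with at most `N` parts, `m ≠ 0`,
characteristic zero). BIP (4.1): `Sym^d Sym^n V = (⊗^{dn} V)^{S_d ≀ S_n}`, on highest-weight vectors
of weight `λ`, in the dual coordinates of `coordRep`. [cite: BurgisserIkenmeyerPanovaJAMS2019, §4 (4.1)] -/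
def highestWeightSpaceCoordRepEquiv (hm : m ≠ 0) (lam : Nat.Partition (n * m))
    (hlam : lam.parts.card ≤ N) :
    ↥(highestWeightSpace (coordRep (Fin N) k m) (Weight.dualOfPartition N lam)) ≃ₗ[k]
      ↥(wreathHW k N (1 : ↥(blockPerms n m) →* ℤˣ) (Weight.ofPartition N lam)) :=
  LinearEquiv.ofBijective (toWreathHW k N hm lam hlam) (toWreathHW_bijective k N hm lam hlam)

/-- **`a_λ(n,m) = dim wreathHW k N 1 λ`**: the plethysm coefficient of the barrier file (multiplicity
of `λ^*` in `k[Symᵐ (k^N)]`) is the dimension of the space of `S_n ≀ S_m`-invariant highest-weight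
vectors of weight `λ` in `(k^N)^{⊗nm}` (`λ ⊢ n·m`, `ℓ(λ) ≤ N`, `m ≠ 0`, characteristic zero).
FI §2 eq. (2) with BIP (4.1). [cite: FischerIkenmeyer2020, §2 (eq. (2))] -/
theorem plethysmCoeffOfPartition_eq_finrank_wreathHW (hm : m ≠ 0) (lam : Nat.Partition (n * m))
    (hlam : lam.parts.card ≤ N) :
    plethysmCoeffOfPartition k N m lam =
      Module.finrank k ↥(wreathHW k N (1 : ↥(blockPerms n m) →* ℤˣ) (Weight.ofPartition N lam)) :=
  (highestWeightSpaceCoordRepEquiv k N hm lam hlam).finrank_eq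

/-- **`a_λ(n,m) = dim wreathHW k N' s λᵀ`** (`s` = the sign of `S_{nm}` restricted to
`S_n ≀ S_m`): the plethysm coefficient is the multiplicity of `λᵀ` in `Λⁿ Λᵐ V` for `m` odd and in
`Symⁿ Λᵐ V` for `m` even — FI Fact 1 read for `Symⁿ Symᵐ` ("`a_λ(n, 3)` … equals the multiplicity
of `S^{λᵀ} V` in `Λⁿ Λ³ V` by Fact 1", proof of Thm. 4); any `N ≥ ℓ(λ)`, `N' ≥ ℓ(λᵀ)`.
[cite: FischerIkenmeyer2020, §2 (Fact 1) and §5 (proof of Thm. 4)] -/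
theorem plethysmCoeffOfPartition_eq_finrank_wreathHW_transpose {N' : ℕ} (hm : m ≠ 0)
    (lam : Nat.Partition (n * m)) (hlam : lam.parts.card ≤ N)
    (hlam' : lam.transpose.parts.card ≤ N') :
    plethysmCoeffOfPartition k N m lam =
      Module.finrank k ↥(wreathHW k N' (restrSign n m) (Weight.ofPartition N' lam.transpose)) := by
  rw [plethysmCoeffOfPartition_eq_finrank_wreathHW k N hm lam hlam,
    finrank_wreathHW_transpose k 1 lam hlam hlam', mul_one]

/-- **Positivity form**: `a_λ(n,m) > 0 ↔ wreathHW k N' s λᵀ ≠ ⊥` (any `N ≥ ℓ(λ)`, `N' ≥ ℓ(λᵀ)`,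
`m ≠ 0`). [cite: FischerIkenmeyer2020, §2 (Fact 1)] -/
theorem plethysmCoeffOfPartition_pos_iff_wreathHW_transpose_ne_bot {N' : ℕ} (hm : m ≠ 0)
    (lam : Nat.Partition (n * m)) (hlam : lam.parts.card ≤ N)
    (hlam' : lam.transpose.parts.card ≤ N') :
    0 < plethysmCoeffOfPartition k N m lam ↔
      wreathHW k N' (restrSign n m) (Weight.ofPartition N' lam.transpose) ≠ ⊥ := by
  rw [plethysmCoeffOfPartition_eq_finrank_wreathHW_transpose k N hm lam hlam hlam',
    wreathHW_ne_bot_iff_finrank_pos]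

/-- **Positivity form, untwisted**: `a_λ(n,m) > 0 ↔ wreathHW k N' 1 λ ≠ ⊥` (any `N, N' ≥ ℓ(λ)`).
[cite: FischerIkenmeyer2020, §2 (eq. (2))] -/
theorem plethysmCoeffOfPartition_pos_iff_wreathHW_ne_bot {N' : ℕ} (hm : m ≠ 0)
    (lam : Nat.Partition (n * m)) (hlam : lam.parts.card ≤ N) (hlam' : lam.parts.card ≤ N') :
    0 < plethysmCoeffOfPartition k N m lam ↔
      wreathHW k N' (1 : ↥(blockPerms n m) →* ℤˣ) (Weight.ofPartition N' lam) ≠ ⊥ := by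
  rw [plethysmCoeffOfPartition_eq_finrank_wreathHW k N hm lam hlam,
    finrank_wreathHW_eq_of_card_le k 1 lam hlam hlam', wreathHW_ne_bot_iff_finrank_pos]

end Dictionary

end Literature.RepresentationTheory.GeneralLinear
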